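import Summits.Ventures.YMGap.Thresholds.ZdSmoothingLipschitz
import Summits.Ventures.YMGap.StrongCouplingGapShape
import Literature.MathematicalPhysics.QuantumFieldTheory.Sweep1ShenZhuZhuProofs
import Literature.Barriers.QuantumFields.DiscreteSubgroupFreezing
import Literature.Barriers.QuantumFields.NonabelianCoulombPhaseD5
import HarnessLib

/-!
# Venture YMGap — the bridge «`MassGapAt d N β` ⇒ every DLR state is MASSIVE»: exponential clustering
# of ALL bounded measurable local observables from the Shen–Zhu–Zhu covariance clause

HONEST FRAMING: venture file (cell `pub-ymgap`, seat ds-3), strong-coupling LATTICE statement for `SU(N)`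
lattice Yang–Mills on `ℤ^d` with the Wilson action ('t Hooft coupling `β`, tree coupling `N β`). WHAT THIS
IS: a currency conversion, kernel-checked and hypothesis-free. The cell's `MassGapAt d N β` (the `β`-body
of the tree's `shen_zhu_zhu`: DLR uniqueness + exponential clustering of LIPSCHITZ CYLINDER functions with
the Shen–Zhu–Zhu constant `c₁ e^{-c d(Λ₁,Λ₂)} (K₁K₂ + ‖F₁‖₂‖F₂‖₂)`) implies, for EVERY DLR state `μ`,
exponential clustering at the SAME rate `c` of `cov_μ(F₁, F₂ ∘ θ_x)` for ALL bounded measurable local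
observables (`covariance_decay_of_lipschitzClustering`, every `d ≥ 1`), i.e. in `d = 4` that `μ` is a
MASSIVE STATE of the barrier catalogue (`Literature.Barriers.QuantumFields.IsMassiveState`, clause (iii)
of the tree's `osterwalder_seiler_strongCoupling`; `isMassiveState_of_massGapAt`) whose plaquette–plaquette
correlation function decays exponentially (`hasExponentialDecay_plaquetteCorrFn_of_massGapAt`). Hence every
`MassGapBelow` / `ImprovedThreshold` row of the cell is at once an every-DLR-state-massive row. WHAT IT IS
NOT: no new threshold, no rate beyond the `∃ c > 0` of `MassGapAt`, nothing about the continuum,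
confinement, a transfer-matrix gap or the Clay problem.

METHOD (all inputs are tree theorems). A DLR state reproduces the kernel averages (`integral_specAvg`,
`integral_specAvg_mul`), so once the collared supports of `F₁` and `F₂ ∘ θ_x` are disjoint
(`‖x‖_∞ > D + 2`, `D` the diameter of the support pair) the covariance of `F₁, F₂ ∘ θ_x` equals that of
the smoothings `γ_{S₁} F₁`, `γ_{S₂ − x}(F₂ ∘ θ_x)` — LIPSCHITZ CYLINDER functions on the collared supports
with constants independent of `x` (`ZdSmoothing.isLipschitzCylinder_specAvg_ymSpecification_card`), of
`L²(μ)`-norm `≤ ‖Fᵢ‖_∞`, at edge-set distance `≥ ‖x‖_∞ − (D + 2)` — and the clustering clause at level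
`n = (1 + 8(d−1))(#S₁ + #S₂)` gives `|cov| ≤ C e^{−c‖x‖_∞}`; the near regime costs `2‖F₁‖_∞‖F₂‖_∞`.

References: H. Shen, R. Zhu, X. Zhu, CMP 400 (2023) 805–851, Thm. 1.2, Cor. 1.4; H.-O. Georgii,
Gibbs Measures and Phase Transitions (2011), Def. 1.23, Prop. 8.8; K. Osterwalder, E. Seiler, Ann. Phys.
110 (1978) 440, §4; S. Chatterjee, arXiv:1803.01950, §4.
-/

noncomputable section

open MeasureTheory ProbabilityTheory Function Finset Filter Topology
open scoped NNReal
open Literature.Probability.LatticeModels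
open Literature.Probability.LatticeModels.DobrushinMetric
open Literature.MathematicalPhysics.QuantumLattice (IsCylinder LGConfig fundamentalRep
  fundamentalRep_apply fundamentalRep_mem_unitaryGroup continuous_fundamentalRep ymSpecification ymGibbsMeasures
  mem_ymGibbsMeasures_iff plaquettesTouching plaquetteEdges mem_plaquettesTouching_iff wilsonBoundaryAction
  integral_ymSpecification dependsOn_integral_ymSpecification infiniteVolumeLimitPoints
  mem_ymGibbsMeasures_of_mem_infiniteVolumeLimitPoints_holds plaquetteCorrFn
  exists_near_of_mem_plaquettesTouching_biUnion)
open Literature.MathematicalPhysics.QuantumFieldTheory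
open Literature.MathematicalPhysics.QuantumFieldTheory.Balaban1983to89
open Literature.MathematicalPhysics.QuantumFieldTheory.Balaban1983to89.StrongCouplingTorusWindow
open Literature.Barriers.QuantumFields (IsMassiveState)
open Summit.Ventures.YMGap.StarLimit
open Summit.Ventures.YMGap.ZdSmoothing

namespace Summit.Ventures.YMGap.MassGapMassive

variable {d N : ℕ}

/-! ### Geometry of a support pair under translation (every `d`) -/

/-- Base points of `S₁ ∪ collar S₁` and of `(S₂ − x) ∪ collar(S₂ − x)`, the latter translated back by
`x`, are within `D + 2` of each other in the sup norm, where `D` bounds `‖a₀ − b₀‖_∞` over `S₁ × S₂`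
(the every-`d` form of `StarLimit.supNorm_le_of_mem_union_collar`). -/
theorem supNorm_le_of_mem_union_collar_dim
    {S₁ S₂ : Finset (Literature.MathematicalPhysics.QuantumLattice.ZdEdge d)} {D : ℕ}
    (hD : ∀ a₀ ∈ S₁, ∀ b₀ ∈ S₂, Site.supNorm (a₀.1 - b₀.1) ≤ D) (x : Site d)
    {a b : Literature.MathematicalPhysics.QuantumLattice.ZdEdge d}
    (ha : a ∈ S₁ ∪ (plaquettesTouching S₁).biUnion plaquetteEdges)
    (hb : b ∈ S₂.image (fun e => (e.1 - x, e.2)) ∪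
      (plaquettesTouching (S₂.image fun e => (e.1 - x, e.2))).biUnion plaquetteEdges) :
    Site.supNorm (a.1 - (b.1 + x)) ≤ D + 2 := by
  obtain ⟨a₀, ha₀, hna⟩ := exists_near_of_mem_union_collar ha
  obtain ⟨b₀', hb₀', hnb⟩ := exists_near_of_mem_union_collar hb
  obtain ⟨b₀, hb₀, rfl⟩ := Finset.mem_image.1 hb₀'
  have hDab := hD a₀ ha₀ b₀ hb₀
  rw [Site.supNorm_le_iff]
  intro j
  have h1 := hna j
  have h2 := hnb j
  have h3 := (Site.natAbs_le_supNorm (a₀.1 - b₀.1) j).trans hDab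
  simp only [Pi.sub_apply, Pi.add_apply] at h1 h2 h3 ⊢
  rw [abs_le] at h1 h2
  omega

/-- The `L²(μ)`-norm of a function bounded by `M` is at most `M` (probability measure). -/
theorem sqrt_integral_sq_le {α : Type*} [MeasurableSpace α] {μ : Measure α} [IsProbabilityMeasure μ]
    {f : α → ℝ} {M : ℝ} (hM : ∀ x, |f x| ≤ M) : Real.sqrt (∫ x, f x ^ 2 ∂μ) ≤ M := by
  obtain ⟨x₀, -⟩ : (Set.univ : Set α).Nonempty :=
    nonempty_of_measure_ne_zero (μ := μ) (by rw [measure_univ]; exact one_ne_zero)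
  have hM0 : 0 ≤ M := (abs_nonneg _).trans (hM x₀)
  have hsq : ∀ x, |f x ^ 2| ≤ M ^ 2 := fun x => by
    rw [abs_pow]
    exact pow_le_pow_left₀ (abs_nonneg _) (hM x) 2
  have h := abs_integral_le_of_abs_le (μ := μ) hsq
  calc Real.sqrt (∫ x, f x ^ 2 ∂μ) ≤ Real.sqrt (M ^ 2) := Real.sqrt_le_sqrt ((le_abs_self _).trans h)
    _ = M := Real.sqrt_sq hM0

/-! ### The bridge: Lipschitz-cylinder clustering under a DLR state ⇒ clustering of all bounded local observables -/

/-- **Covariance decay of ALL bounded measurable local observables under a DLR state, from the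
Shen–Zhu–Zhu clustering clause for Lipschitz cylinder functions** (`SU(N)`, every `d`, tree coupling
`b`). If `μ` is a DLR state of `ymSpecification (fundamentalRep (Fin N)) b` under which, for some rate
`c > 0` and every support size `n`, Lipschitz cylinder functions with disjoint supports of size `≤ n`
cluster as `|cov_μ(G₁,G₂)| ≤ c₁(n) e^{−c d(Λ₁,Λ₂)} (K₁K₂ + ‖G₁‖₂‖G₂‖₂)` (the `μ`-clause of `MassGapAt`),
then for every pair of bounded measurable local observables `F₁, F₂` there is `C` with
`|cov_μ(F₁, F₂ ∘ θ_x)| ≤ C e^{−c‖x‖_∞}` for all `x ∈ ℤ^d` — the SAME rate `c`. -/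
theorem covariance_decay_of_lipschitzClustering (hd : 1 ≤ d) (hN : 1 ≤ N) (b : ℝ)
    {μ : Measure (LGConfig d (Matrix.specialUnitaryGroup (Fin N) ℂ))}
    (hμ : μ ∈ ymGibbsMeasures (d := d) (fundamentalRep (Fin N)) b) {c : ℝ} (hc : 0 < c)
    (hcl : ∀ n : ℕ, ∃ c₁ : ℝ,
      ∀ (G₁ G₂ : LGConfig d (Matrix.specialUnitaryGroup (Fin N) ℂ) → ℝ)
        (Λ₁ Λ₂ : Finset (Literature.MathematicalPhysics.QuantumLattice.ZdEdge d)) (K₁ K₂ : ℝ≥0),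
        Λ₁.card ≤ n → Λ₂.card ≤ n → Disjoint Λ₁ Λ₂ →
        IsLipschitzCylinder (fundamentalRep (Fin N)) G₁ Λ₁ K₁ →
        IsLipschitzCylinder (fundamentalRep (Fin N)) G₂ Λ₂ K₂ →
          |cov[G₁, G₂; μ]| ≤ c₁ * Real.exp (-c * setDistEdges Λ₁ Λ₂) *
            ((K₁ : ℝ) * K₂ + Real.sqrt (∫ U, G₁ U ^ 2 ∂μ) * Real.sqrt (∫ U, G₂ U ^ 2 ∂μ)))
    (F₁ F₂ : LGConfig d (Matrix.specialUnitaryGroup (Fin N) ℂ) → ℝ)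
    (h₁ : Literature.MathematicalPhysics.QuantumLattice.IsLocalObservable F₁)
    (h₂ : Literature.MathematicalPhysics.QuantumLattice.IsLocalObservable F₂) (h₁m : Measurable F₁) (h₂m : Measurable F₂)
    (hb₁ : ∃ C, ∀ U, |F₁ U| ≤ C) (hb₂ : ∃ C, ∀ U, |F₂ U| ≤ C) :
    ∃ C : ℝ, ∀ x : Site d, |cov[F₁, fun U => F₂ (Literature.MathematicalPhysics.QuantumLattice.configShift x U); μ]| ≤ C * Real.exp (-c * ‖x‖) := by
  classical
  haveI : SecondCountableTopology (Matrix (Fin N) (Fin N) ℂ) :=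
    inferInstanceAs (SecondCountableTopology (Fin N → Fin N → ℂ))
  haveI : SecondCountableTopology (Matrix.specialUnitaryGroup (Fin N) ℂ) :=
    Topology.IsEmbedding.subtypeVal.secondCountableTopology
  have hρc := continuous_fundamentalRep (Fin N)
  set γ := ymSpecification (d := d) (fundamentalRep (Fin N)) b with hγdef
  have hγ : IsSpecification γ := isSpecification_ymSpecification_of_t2Space _ hρc _
  have hGibbs : IsGibbsMeasure γ μ := (mem_ymGibbsMeasures_iff _ _ _).1 hμ
  haveI : IsProbabilityMeasure μ := hGibbs.isProbabilityMeasure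
  -- supports (made non-empty by adjoining one fixed link) and bounds
  obtain ⟨S₁', hS₁'⟩ := h₁
  obtain ⟨S₂', hS₂'⟩ := h₂
  obtain ⟨M₁, hM₁⟩ := hb₁
  obtain ⟨M₂, hM₂⟩ := hb₂
  set e₀ : Literature.MathematicalPhysics.QuantumLattice.ZdEdge d := ((0 : Site d), (⟨0, hd⟩ : Fin d)) with he₀
  set S₁ : Finset (Literature.MathematicalPhysics.QuantumLattice.ZdEdge d) := insert e₀ S₁' with hS₁def
  set S₂ : Finset (Literature.MathematicalPhysics.QuantumLattice.ZdEdge d) := insert e₀ S₂' with hS₂def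
  have hS₁ : IsCylinder F₁ S₁ :=
    DependsOn.mono (fun e he => Finset.mem_coe.2 (Finset.mem_insert_of_mem (Finset.mem_coe.1 he))) hS₁'
  have hS₂ : IsCylinder F₂ S₂ :=
    DependsOn.mono (fun e he => Finset.mem_coe.2 (Finset.mem_insert_of_mem (Finset.mem_coe.1 he))) hS₂'
  have hS₁ne : S₁.Nonempty := Finset.insert_nonempty _ _
  have hS₂ne : S₂.Nonempty := Finset.insert_nonempty _ _
  have hM₁0 : 0 ≤ M₁ := (abs_nonneg _).trans (hM₁ fun _ => 1)
  have hM₂0 : 0 ≤ M₂ := (abs_nonneg _).trans (hM₂ fun _ => 1)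
  have hD : ∀ a₀ ∈ S₁, ∀ b₀ ∈ S₂, Site.supNorm (a₀.1 - b₀.1) ≤
      (S₁ ×ˢ S₂).sup fun ab => Site.supNorm (ab.1.1 - ab.2.1) :=
    fun a₀ ha₀ b₀ hb₀ => Finset.le_sup
      (f := fun ab : Literature.MathematicalPhysics.QuantumLattice.ZdEdge d ×
          Literature.MathematicalPhysics.QuantumLattice.ZdEdge d => Site.supNorm (ab.1.1 - ab.2.1))
      (Finset.mk_mem_product ha₀ hb₀)
  generalize ((S₁ ×ˢ S₂).sup fun ab => Site.supNorm (ab.1.1 - ab.2.1)) = D at hD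
  set n : ℕ := (1 + 4 * (2 * (d - 1))) * S₁.card + (1 + 4 * (2 * (d - 1))) * S₂.card with hndef
  obtain ⟨c₁, hc₁⟩ := hcl n
  set c₁' : ℝ := max c₁ 0 with hc₁'
  have hc₁'0 : 0 ≤ c₁' := le_max_right _ _
  set K₁ : ℝ≥0 := (((((1 + 4 * (2 * (d - 1))) * S₁.card : ℕ) : ℝ)) * N * (M₁ * wilsonSmoothLip N d b)).toNNReal
    with hK₁
  set K₂ : ℝ≥0 := (((((1 + 4 * (2 * (d - 1))) * S₂.card : ℕ) : ℝ)) * N * (M₂ * wilsonSmoothLip N d b)).toNNReal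
    with hK₂
  set Kfar : ℝ := Real.exp (c * ((D + 2 : ℕ) : ℝ)) with hKfar
  have hKfar0 : 0 < Kfar := Real.exp_pos _
  set A : ℝ := c₁' * ((K₁ : ℝ) * K₂ + M₁ * M₂) with hAdef
  have hA0 : 0 ≤ A := by positivity
  refine ⟨(2 * M₁ * M₂ + A) * Kfar, fun x => ?_⟩
  set Gx : LGConfig d (Matrix.specialUnitaryGroup (Fin N) ℂ) → ℝ := F₂ ∘ Literature.MathematicalPhysics.QuantumLattice.configShift x with hGxdef
  obtain ⟨S₂x, hS₂x⟩ : ∃ S : Finset (Literature.MathematicalPhysics.QuantumLattice.ZdEdge d),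
      S = S₂.image fun e => (e.1 - x, e.2) := ⟨_, rfl⟩
  have hGxS : IsCylinder Gx S₂x := by rw [hS₂x]; exact IsCylinder.comp_configShift hS₂ x
  have hGxm : Measurable Gx := h₂m.comp (Literature.MathematicalPhysics.QuantumLattice.configShift x).measurable
  have hGxM : ∀ U, |Gx U| ≤ M₂ := fun U => hM₂ _
  have hS₂xcard : S₂x.card ≤ S₂.card := by rw [hS₂x]; exact Finset.card_image_le
  have hL2 : ∀ {f : LGConfig d (Matrix.specialUnitaryGroup (Fin N) ℂ) → ℝ} {M : ℝ}, Measurable f →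
      (∀ U, |f U| ≤ M) → MemLp f 2 μ := fun hf hfM =>
    memLp_of_bounded (ae_of_all _ fun U => abs_le.1 (hfM U)) hf.aestronglyMeasurable 2
  have hcov : cov[F₁, fun U => F₂ (Literature.MathematicalPhysics.QuantumLattice.configShift x U); μ] =
      (∫ U, F₁ U * Gx U ∂μ) - (∫ U, F₁ U ∂μ) * ∫ U, Gx U ∂μ :=
    covariance_eq_sub (hL2 h₁m hM₁) (hL2 hGxm hGxM)
  have hexp0 : 0 < Real.exp (-c * (Site.supNorm x : ℕ)) := Real.exp_pos _
  rw [Site.norm_eq_supNorm x]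
  by_cases hnear : Site.supNorm x ≤ D + 2
  · -- NEAR: the trivial bound `|cov| ≤ 2 M₁ M₂` and `Kfar e^{-c ‖x‖} ≥ 1`
    rw [hcov]
    have htriv : |(∫ U, F₁ U * Gx U ∂μ) - (∫ U, F₁ U ∂μ) * ∫ U, Gx U ∂μ| ≤ 2 * M₁ * M₂ := by
      refine (abs_sub _ _).trans ?_
      have e1 := abs_integral_le_of_abs_le (μ := μ) (abs_mul_le_of_abs_le hM₁ hGxM)
      have e2 : |(∫ U, F₁ U ∂μ) * ∫ U, Gx U ∂μ| ≤ M₁ * M₂ := by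
        rw [abs_mul]
        exact mul_le_mul (abs_integral_le_of_abs_le hM₁) (abs_integral_le_of_abs_le hGxM)
          (abs_nonneg _) hM₁0
      linarith
    have hone : 1 ≤ Kfar * Real.exp (-c * (Site.supNorm x : ℕ)) := by
      rw [hKfar, ← Real.exp_add]
      refine Real.one_le_exp ?_
      have : ((Site.supNorm x : ℕ) : ℝ) ≤ ((D + 2 : ℕ) : ℝ) := by exact_mod_cast hnear
      nlinarith
    refine htriv.trans ?_
    have h2MM : 0 ≤ 2 * M₁ * M₂ := by positivity
    calc 2 * M₁ * M₂ ≤ 2 * M₁ * M₂ * (Kfar * Real.exp (-c * (Site.supNorm x : ℕ))) :=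
          le_mul_of_one_le_right h2MM hone
      _ ≤ (2 * M₁ * M₂ + A) * (Kfar * Real.exp (-c * (Site.supNorm x : ℕ))) :=
          mul_le_mul_of_nonneg_right (le_add_of_nonneg_right hA0) (mul_nonneg hKfar0.le hexp0.le)
      _ = (2 * M₁ * M₂ + A) * Kfar * Real.exp (-c * (Site.supNorm x : ℕ)) := by ring
  -- FAR: `D + 2 < ‖x‖_∞`; DLR smoothing of both observables
  rw [not_le] at hnear
  set f₁ : LGConfig d (Matrix.specialUnitaryGroup (Fin N) ℂ) → ℝ := specAvg γ S₁ F₁ with hf₁def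
  set g₂ : LGConfig d (Matrix.specialUnitaryGroup (Fin N) ℂ) → ℝ := specAvg γ S₂x Gx with hg₂def
  have hf₁m : Measurable f₁ := measurable_specAvg hγ S₁ h₁m
  have hg₂m : Measurable g₂ := measurable_specAvg hγ S₂x hGxm
  have hf₁M : ∀ U, |f₁ U| ≤ M₁ := abs_specAvg_le hγ S₁ hM₁
  have hg₂M : ∀ U, |g₂ U| ≤ M₂ := abs_specAvg_le hγ S₂x hGxM
  obtain ⟨T₁, hT₁⟩ : ∃ T : Finset (Literature.MathematicalPhysics.QuantumLattice.ZdEdge d),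
      T = S₁ ∪ (plaquettesTouching S₁).biUnion plaquetteEdges := ⟨_, rfl⟩
  obtain ⟨T₂, hT₂⟩ : ∃ T : Finset (Literature.MathematicalPhysics.QuantumLattice.ZdEdge d),
      T = S₂x ∪ (plaquettesTouching S₂x).biUnion plaquetteEdges := ⟨_, rfl⟩
  have hf₁T : IsCylinder f₁ T₁ := by
    rw [hT₁]
    exact dependsOn_integral_ymSpecification (fundamentalRep (Fin N)) hρc b S₁ h₁m hS₁
  have hg₂T : IsCylinder g₂ T₂ := by
    rw [hT₂]
    exact dependsOn_integral_ymSpecification (fundamentalRep (Fin N)) hρc b S₂x hGxm hGxS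
  -- the smoothings are Lipschitz cylinder functions with the displacement-free constants `K₁`, `K₂`
  have hf₁L : IsLipschitzCylinder (fundamentalRep (Fin N)) f₁ T₁ K₁ := by
    rw [hT₁]
    exact isLipschitzCylinder_specAvg_ymSpecification_card hN b S₁ h₁m hS₁ hM₁ le_rfl
  have hg₂L : IsLipschitzCylinder (fundamentalRep (Fin N)) g₂ T₂ K₂ := by
    rw [hT₂]
    exact isLipschitzCylinder_specAvg_ymSpecification_card hN b S₂x hGxm hGxS hGxM hS₂xcard
  -- geometry: base points of `T₁` and `T₂ + x` are within `D + 2`; hence `T₁ ∩ T₂ = ∅` and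
  -- `d(T₁, T₂) ≥ ‖x‖_∞ − (D + 2)`
  have hxD : ∀ a ∈ T₁, ∀ b' ∈ T₂, Site.supNorm (a.1 - (b'.1 + x)) ≤ D + 2 := by
    intro a ha b' hb
    rw [hT₁] at ha
    rw [hT₂, hS₂x] at hb
    exact supNorm_le_of_mem_union_collar_dim hD x ha hb
  have hdisj : ∀ a ∈ T₁, ∀ b' ∈ T₂, a ≠ b' := by
    intro a ha b' hb hab
    subst hab
    have h := hxD a ha a hb
    have hax : a.1 - (a.1 + x) = -x := sub_add_cancel_left a.1 x
    have hneg : Site.supNorm (-x) = Site.supNorm x := by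
      simp only [Site.supNorm, Pi.neg_apply, Int.natAbs_neg]
    rw [hax, hneg] at h
    omega
  have hdisjT : Disjoint T₁ T₂ := Finset.disjoint_left.2 fun a ha hb => hdisj a ha a hb rfl
  have hT₁ne : T₁.Nonempty := by
    rw [hT₁]; exact hS₁ne.mono Finset.subset_union_left
  have hT₂ne : T₂.Nonempty := by
    rw [hT₂]
    have : S₂x.Nonempty := by rw [hS₂x]; exact hS₂ne.image _
    exact this.mono Finset.subset_union_left
  have hdist : ((Site.supNorm x : ℕ) : ℝ) - ((D + 2 : ℕ) : ℝ) ≤ setDistEdges T₁ T₂ := by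
    refine le_setDistEdges_of_forall hT₁ne hT₂ne fun a ha b' hb => ?_
    have h1 : ‖a.1 - (b'.1 + x)‖ ≤ ((D + 2 : ℕ) : ℝ) := by
      rw [Site.norm_eq_supNorm]; exact_mod_cast hxD a ha b' hb
    have h2 : ‖x‖ ≤ ‖a.1 - b'.1‖ + ‖a.1 - (b'.1 + x)‖ := by
      have e : x = (a.1 - b'.1) - (a.1 - (b'.1 + x)) := by abel
      calc ‖x‖ = ‖(a.1 - b'.1) - (a.1 - (b'.1 + x))‖ := by rw [← e]
        _ ≤ ‖a.1 - b'.1‖ + ‖a.1 - (b'.1 + x)‖ := norm_sub_le _ _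
    rw [← Site.norm_eq_supNorm x]
    linarith
  have hcard₁ : T₁.card ≤ n := by
    rw [hT₁]
    exact (card_union_collar_le S₁).trans (Nat.le_add_right _ _)
  have hcard₂ : T₂.card ≤ n := by
    rw [hT₂]
    exact ((card_union_collar_le S₂x).trans (Nat.mul_le_mul_left _ hS₂xcard)).trans (Nat.le_add_left _ _)
  -- DLR smoothing: the three integrals are unchanged
  have hI₁ : ∫ U, F₁ U * Gx U ∂μ = ∫ U, f₁ U * g₂ U ∂μ := by
    have hS₁T₁ : ∀ e ∈ S₁, e ∈ T₁ := fun e he => by rw [hT₁]; exact Finset.mem_union_left _ he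
    have hS₂T₂ : ∀ e ∈ S₂x, e ∈ T₂ := fun e he => by rw [hT₂]; exact Finset.mem_union_left _ he
    have ha : ∫ U, f₁ U * Gx U ∂μ = ∫ U, F₁ U * Gx U ∂μ :=
      integral_specAvg_mul hγ hGibbs S₁ h₁m hM₁ hGxm hGxM hGxS fun e he heS =>
        hdisj e (hS₁T₁ e he) e (hS₂T₂ e (Finset.mem_coe.1 heS)) rfl
    have hb' : ∫ U, g₂ U * f₁ U ∂μ = ∫ U, Gx U * f₁ U ∂μ :=
      integral_specAvg_mul hγ hGibbs S₂x hGxm hGxM hf₁m hf₁M hf₁T fun e he heT =>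
        hdisj e (Finset.mem_coe.1 heT) e (hS₂T₂ e he) rfl
    calc ∫ U, F₁ U * Gx U ∂μ = ∫ U, f₁ U * Gx U ∂μ := ha.symm
      _ = ∫ U, Gx U * f₁ U ∂μ := integral_congr_ae (ae_of_all _ fun U => mul_comm _ _)
      _ = ∫ U, g₂ U * f₁ U ∂μ := hb'.symm
      _ = ∫ U, f₁ U * g₂ U ∂μ := integral_congr_ae (ae_of_all _ fun U => mul_comm _ _)
  have hI₂ : ∫ U, F₁ U ∂μ = ∫ U, f₁ U ∂μ := (integral_specAvg hγ hGibbs S₁ h₁m hM₁).symm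
  have hI₃ : ∫ U, Gx U ∂μ = ∫ U, g₂ U ∂μ := (integral_specAvg hγ hGibbs S₂x hGxm hGxM).symm
  have hcov' : cov[F₁, fun U => F₂ (Literature.MathematicalPhysics.QuantumLattice.configShift x U); μ] = cov[f₁, g₂; μ] := by
    rw [hcov, hI₁, hI₂, hI₃]
    exact (covariance_eq_sub (hL2 hf₁m hf₁M) (hL2 hg₂m hg₂M)).symm
  rw [hcov']
  have hcl' := hc₁ f₁ g₂ T₁ T₂ K₁ K₂ hcard₁ hcard₂ hdisjT hf₁L hg₂L
  have hL2₁ : Real.sqrt (∫ U, f₁ U ^ 2 ∂μ) ≤ M₁ := sqrt_integral_sq_le hf₁M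
  have hL2₂ : Real.sqrt (∫ U, g₂ U ^ 2 ∂μ) ≤ M₂ := sqrt_integral_sq_le hg₂M
  have hB : (K₁ : ℝ) * K₂ + Real.sqrt (∫ U, f₁ U ^ 2 ∂μ) * Real.sqrt (∫ U, g₂ U ^ 2 ∂μ) ≤
      (K₁ : ℝ) * K₂ + M₁ * M₂ :=
    add_le_add le_rfl (mul_le_mul hL2₁ hL2₂ (Real.sqrt_nonneg _) hM₁0)
  have hB0 : 0 ≤ (K₁ : ℝ) * K₂ + Real.sqrt (∫ U, f₁ U ^ 2 ∂μ) * Real.sqrt (∫ U, g₂ U ^ 2 ∂μ) := by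
    positivity
  have hexp : Real.exp (-c * setDistEdges T₁ T₂) ≤ Kfar * Real.exp (-c * (Site.supNorm x : ℕ)) := by
    rw [hKfar, ← Real.exp_add]
    refine Real.exp_le_exp.2 ?_
    nlinarith
  refine hcl'.trans ?_
  calc c₁ * Real.exp (-c * setDistEdges T₁ T₂) *
        ((K₁ : ℝ) * K₂ + Real.sqrt (∫ U, f₁ U ^ 2 ∂μ) * Real.sqrt (∫ U, g₂ U ^ 2 ∂μ))
      ≤ c₁' * Real.exp (-c * setDistEdges T₁ T₂) *
        ((K₁ : ℝ) * K₂ + Real.sqrt (∫ U, f₁ U ^ 2 ∂μ) * Real.sqrt (∫ U, g₂ U ^ 2 ∂μ)) :=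
        mul_le_mul_of_nonneg_right (mul_le_mul_of_nonneg_right (le_max_left _ _) (Real.exp_pos _).le) hB0
    _ ≤ c₁' * (Kfar * Real.exp (-c * (Site.supNorm x : ℕ))) * ((K₁ : ℝ) * K₂ + M₁ * M₂) :=
        mul_le_mul (mul_le_mul_of_nonneg_left hexp hc₁'0) hB hB0
          (mul_nonneg hc₁'0 (mul_nonneg hKfar0.le hexp0.le))
    _ = A * Kfar * Real.exp (-c * (Site.supNorm x : ℕ)) := by rw [hAdef]; ring
    _ ≤ (2 * M₁ * M₂ + A) * Kfar * Real.exp (-c * (Site.supNorm x : ℕ)) := by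
        refine mul_le_mul_of_nonneg_right (mul_le_mul_of_nonneg_right ?_ hKfar0.le) hexp0.le
        exact le_add_of_nonneg_left (by positivity)

/-! ### `d = 4`: `MassGapAt` ⇒ every DLR state is massive, with plaquette–plaquette decay -/

/-- ★ **`MassGapAt 4 N β` ⇒ EVERY DLR STATE IS MASSIVE** (`SU(N)` lattice Yang–Mills on `ℤ⁴`, Wilson
action, 't Hooft coupling `β`, every `N ≥ 1`): clause (ii) of the cell's `MassGapAt` (Shen–Zhu–Zhu
clustering of Lipschitz cylinder functions) upgrades, by DLR smoothing and at the same rate, to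
`Literature.Barriers.QuantumFields.IsMassiveState μ` for every DLR state `μ` at tree coupling `N β`. -/
theorem isMassiveState_of_massGapAt (hN : 1 ≤ N) {β : ℝ} (h : MassGapAt 4 N β) :
    ∀ μ ∈ ymGibbsMeasures (d := 4) (fundamentalRep (Fin N)) ((N : ℝ) * β), IsMassiveState μ := by
  intro μ hμ
  obtain ⟨c, hc, hcl⟩ := h.2 μ hμ
  refine ⟨c, fun F₁ F₂ h₁ h₂ h₁m h₂m hb₁ hb₂ _ _ => ?_⟩
  obtain ⟨C, hC⟩ := covariance_decay_of_lipschitzClustering (d := 4) (by norm_num) hN ((N : ℝ) * β) hμ hc hcl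
    F₁ F₂ h₁ h₂ h₁m h₂m hb₁ hb₂
  exact ⟨hc, C, hC⟩

/-- **Plaquette–plaquette decay of every DLR state from `MassGapAt`**: under `MassGapAt 4 N β` the
plaquette–plaquette correlation function `plaquetteCorrFn` (Chatterjee's `f_β`) of every DLR state decays
exponentially (tree criterion `not_exists_clusteringRate_of_not_hasExponentialDecay_plaquetteCorrFn`). -/
theorem hasExponentialDecay_plaquetteCorrFn_of_massGapAt (hN : 1 ≤ N) {β : ℝ} (h : MassGapAt 4 N β) :
    ∀ μ ∈ ymGibbsMeasures (d := 4) (fundamentalRep (Fin N)) ((N : ℝ) * β),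
      HasExponentialDecay (plaquetteCorrFn (fundamentalRep (Fin N)) μ) := by
  intro μ hμ
  haveI : SecondCountableTopology (Matrix (Fin N) (Fin N) ℂ) :=
    inferInstanceAs (SecondCountableTopology (Fin N → Fin N → ℂ))
  haveI : SecondCountableTopology (Matrix.specialUnitaryGroup (Fin N) ℂ) :=
    Topology.IsEmbedding.subtypeVal.secondCountableTopology
  have hGibbs : IsGibbsMeasure (ymSpecification (d := 4) (fundamentalRep (Fin N)) ((N : ℝ) * β)) μ :=
    (mem_ymGibbsMeasures_iff _ _ _).1 hμ
  haveI : IsProbabilityMeasure μ := hGibbs.isProbabilityMeasure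
  have hm := isMassiveState_of_massGapAt hN h μ hμ
  by_contra hneg
  exact Literature.Barriers.QuantumFields.not_exists_clusteringRate_of_not_hasExponentialDecay_plaquetteCorrFn
    (fundamentalRep (Fin N)) (continuous_fundamentalRep (Fin N))
    (fun U => fundamentalRep_mem_unitaryGroup U) hneg hm

/-- **Limit states too**: every infinite-volume limit point of the torus Wilson states is a DLR state
(`mem_ymGibbsMeasures_of_mem_infiniteVolumeLimitPoints_holds`), hence massive under `MassGapAt 4 N β`. -/
theorem isMassiveState_limit_of_massGapAt (hN : 1 ≤ N) {β : ℝ} (h : MassGapAt 4 N β) :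
    ∀ μ ∈ infiniteVolumeLimitPoints (d := 4) (fundamentalRep (Fin N)) ((N : ℝ) * β), IsMassiveState μ := by
  intro μ hμ
  haveI : SecondCountableTopology (Matrix (Fin N) (Fin N) ℂ) :=
    inferInstanceAs (SecondCountableTopology (Fin N → Fin N → ℂ))
  haveI : SecondCountableTopology (Matrix.specialUnitaryGroup (Fin N) ℂ) :=
    Topology.IsEmbedding.subtypeVal.secondCountableTopology
  exact isMassiveState_of_massGapAt hN h μ
    (mem_ymGibbsMeasures_of_mem_infiniteVolumeLimitPoints_holds (d := 4) (fundamentalRep (Fin N))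
      (continuous_fundamentalRep (Fin N)) hμ)

/-- **Window form**: `MassGapBelow 4 N β₀` ⇒ at every 't Hooft `|β| < β₀` every DLR state of `SU(N)`
lattice Yang–Mills on `ℤ⁴` is massive. -/
theorem isMassiveState_of_massGapBelow (hN : 1 ≤ N) {β₀ : ℝ} (h : MassGapBelow 4 N β₀) {β : ℝ}
    (hβ : |β| < β₀) :
    ∀ μ ∈ ymGibbsMeasures (d := 4) (fundamentalRep (Fin N)) ((N : ℝ) * β), IsMassiveState μ :=
  isMassiveState_of_massGapAt hN (h β hβ)

/-- **Window form, plaquette decay** of every DLR state at every 't Hooft `|β| < β₀`. -/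
theorem hasExponentialDecay_plaquetteCorrFn_of_massGapBelow (hN : 1 ≤ N) {β₀ : ℝ} (h : MassGapBelow 4 N β₀)
    {β : ℝ} (hβ : |β| < β₀) :
    ∀ μ ∈ ymGibbsMeasures (d := 4) (fundamentalRep (Fin N)) ((N : ℝ) * β),
      HasExponentialDecay (plaquetteCorrFn (fundamentalRep (Fin N)) μ) :=
  hasExponentialDecay_plaquetteCorrFn_of_massGapAt hN (h β hβ)

/-- **Target-type form**: an `ImprovedThreshold 4 N β₀'` (the cell's track-(a) target type) carries,
at every 't Hooft `|β| < β₀'`, massiveness of every DLR state. -/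
theorem isMassiveState_of_improvedThreshold (hN : 1 ≤ N) {β₀' : ℝ} (h : ImprovedThreshold 4 N β₀')
    {β : ℝ} (hβ : |β| < β₀') :
    ∀ μ ∈ ymGibbsMeasures (d := 4) (fundamentalRep (Fin N)) ((N : ℝ) * β), IsMassiveState μ :=
  isMassiveState_of_massGapBelow hN h.2 hβ

/-- **Target-type form, plaquette decay.** -/
theorem hasExponentialDecay_plaquetteCorrFn_of_improvedThreshold (hN : 1 ≤ N) {β₀' : ℝ}
    (h : ImprovedThreshold 4 N β₀') {β : ℝ} (hβ : |β| < β₀') :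
    ∀ μ ∈ ymGibbsMeasures (d := 4) (fundamentalRep (Fin N)) ((N : ℝ) * β),
      HasExponentialDecay (plaquetteCorrFn (fundamentalRep (Fin N)) μ) :=
  hasExponentialDecay_plaquetteCorrFn_of_massGapBelow hN h.2 hβ

end Summit.Ventures.YMGap.MassGapMassive

end
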